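import Summits.BirchSwinnertonDyer.BirchSwinnertonDyer.Theorems.KolyvaginRoadThreeCruxIffLeaf
import Summits.BirchSwinnertonDyer.Rank1Residual.X2.RankOneDescentConverse
import HarnessLib

/-!
# Route `KolyvaginRoadThree`, deciding crux `ZhangSharpFrameAtThreeHL` (item stmt-BirchSwinnertonDyer-19574): the
# Tamagawa binder `¬ 3 ∣ ∏c` is SHARP — granted `BSD(E,3)`, every mod-3 Kolyvagin class VANISHES at every
# Hoffstein–Luo frame of an X11b@3 ∧ (ram) curve with `3 ∣ ∏ c_ℓ` (MEMO-v6 LEMMA V, now a tree theorem)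
# (cell `bsd-stepL`, seat `bsd-stepL-zhang3-p1` g3; `--supports stmt-BirchSwinnertonDyer-19574`, helper)

THEOREMS ONLY (no definition, no named fact, no `sorry`); nothing about Kolyvagin's conjecture at `p = 3` and nothing
about `BSD(E,3)` is asserted (`BSDp W 3` is a HYPOTHESIS throughout); every published input is a named fact of the
tree taken as a binder. PARTITION: O2@3 (B10) × (T2′)@3 (the Tamagawa cells (ram) ∧ 3 ∣ ∏c, 568 TRUE-OPEN) ∪ A1 —
types-the-object-of (why the Kolyvagin road's locus of record is A1 and not all of (ram)); closes: none.

THE POINT. W. Zhang 2014 Thm. 1.1 ∕ Skinner–Zhang carry the hypothesis `p ∤ ∏ c_ℓ` (♠ ∕ (c)); Jetchev 2008 and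
koly's MEMO-v6 LEMMA V explain that it is NECESSARY: granted the BSD formula, `M_∞ = ord_p ∏ c_ℓ`, so on a Tamagawa
cell no class `c₁(n)` survives mod `p`. At `p = 3 ∥ N` this is now a theorem of the tree modulo published inputs:
`BSDp W 3` at an X11b@3 ∧ (ram) curve gives the Heegner-index IDENTITY over every Hoffstein–Luo field
(`X2.indexIdentityAt_of_bsdp`, eisenstein-p2: `2·ord₃ ∏c + ord₃ #Ш(E/K) = 2·ord₃[E(K):ℤP] = 2M₀`), while a non-zero
`c₁(n)` would be a level-1 certificate forcing `2M₀ ≤ ord₃ #Ш(E/K)[3^∞]` (McCallum Cor. 5.6, certificate half) —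
incompatible with `3 ∣ ∏c`. Together with `KolyvaginRoadThreeCruxIffLeaf.lean`: on X11b@3 ∧ (ram) ∧ HL frames,
GRANTED `BSDp W 3`, «some `c₁(n) ≠ 0`» ⟺ `3 ∤ ∏ c_ℓ` — Zhang's Tamagawa condition is exactly sharp at 3, and the
HL crux's binder `¬ 3 ∣ W.tamagawaProduct` cannot be dropped (its conclusion is FALSE on every Tamagawa cell where
BSD₃ holds).

* `Koly.kolyvaginClass_one_eq_zero_of_bsdp_of_dvd_tamagawa` — LEMMA V at one HL frame;
* `Koly.exists_kolyvaginClass_one_ne_zero_iff_not_dvd_tamagawa_of_bsdp` — the dichotomy, granted `BSDp W 3`;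
* `Theorems.not_zhangFrameHL_dropTam_of_bsdp_at_tamagawaCell` — tightness of the route item's Tamagawa binder:
  ONE X11b@3 ∧ (ram) curve with `3 ∣ ∏c`, `BSDp W 3` and an HL frame refutes the binder-less statement.

References (locators only): [cite: WZhang2014, Thm. 1.1 (hypothesis on c_ℓ), Remark 5, Thm. 10.2] [cite: Jetchev2008,
§1 (1) and Cor. 1.5 (p. 812)] [cite: McCallumLMS1991, §5 Lemma 5.1 and Cor. 5.6 (p. 310)] [cite: GrossLMS1991, §3,
§4 (4.1)] [cite: Skinner2016PacificMC, Thm. C] [cite: JetchevSkinnerWan2017, §7.4.1–7.4.3 and (eq:tamK)].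
-/

noncomputable section

open scoped Classical

namespace Summit.BirchSwinnertonDyer.Rank1Residual.X11b.Three.Koly

open WeierstrassCurve NumberField Literature.NumberTheory.EllipticCurves
  Literature.NumberTheory.EllipticCurves.ModularForms
  Literature.NumberTheory.EllipticCurves.Rank1Residual
  Summit.BirchSwinnertonDyer.Rank1Residual Summit.BirchSwinnertonDyer.Rank1Residual.X11b

/-! ## §1 LEMMA V at one Hoffstein–Luo frame -/

/-- **LEMMA V (koly MEMO-v6) in the tree: granted `BSD(E,3)`, EVERY mod-3 Kolyvagin class vanishes on a Tamagawa
cell.** Data: `W/ℚ` globally minimal with `(E,3) ∈ X11b`, a (ram) witness and `3 ∣ ∏_ℓ c_ℓ(E)`; `K` imaginary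
quadratic, `d_K` odd, Heegner for `N_E`, `L(E^{d_K},1) ≠ 0`; a frame `(Dt, β, ι)` with `4N ∣ β² − d_K`, `3 ∤ c(Dt)`;
HYPOTHESIS `BSDp W 3`. PUBLISHED inputs as binders (Gross–Zagier, Kolyvagin, Skinner 2016 Thm. C, GZK, modularity,
Shimura reciprocity at conductor 1, Gross 1991 §3 ×2, McCallum Cor. 5.6 certificate half). CONCLUSION: for every
square-free product `n` of Zhang–Kolyvagin primes (n = 1 allowed) and every Kolyvagin–Heegner datum `d` of conductor
`n` on the frame, `c₁(n) = 0`. Proof: `BSDp W 3` ⟹ `X2.indexIdentityAt_of_bsdp` (with the odd-`p` twist transports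
of `BDPRouteOddPrime`): `2·ord₃ ∏c + ord₃ #Ш(E/K) = 2·ord₃[E(K):ℤP] = 2M₀`; a non-zero `c₁(n)` is a level-1
certificate (`not_pDiv_of_kolyvaginClass_ne_zero`), whence `2M₀ ≤ ord₃ #Ш(E/K)[3^∞]` by McCallum; so `ord₃ ∏c = 0`,
contradicting `3 ∣ ∏c`. CONDITIONAL on every binder; nothing is booked. [cite: WZhang2014, Thm. 1.1 and Thm. 10.2]
[cite: Jetchev2008, §1 (1)] [cite: McCallumLMS1991, §5 Lemma 5.1 and Cor. 5.6] -/
theorem kolyvaginClass_one_eq_zero_of_bsdp_of_dvd_tamagawa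
    (W : WeierstrassCurve ℚ) [W.IsElliptic] [W.IsGloballyMinimal] [NeZero (W.conductorNorm ℤ)]
    (K : Type) [Field K] [NumberField K]
    (Dt : ModularParametrizationData W (W.conductorNorm ℤ)) (β : ℤ) (ι : K →+* ℂ)
    -- published inputs (named facts of the tree)
    (hGZ : gross_zagier (W.conductorNorm ℤ) W K) (hKo : kolyvagin (W.conductorNorm ℤ) W K)
    (hSk : Skinner2016.thmC_padicValRat_bsd_rank_zero)
    (hGZK : rank_eq_analyticRank_of_analyticRank_le_one) (hmod : hasEntireLFunction_rat)
    (hrec : heegnerPointOfConductor_one_galoisConj (W.conductorNorm ℤ) W K)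
    (h1 : phi_heegnerPointOfConductor_mem_range_map_ringClassField (W.conductorNorm ℤ) W K)
    (h2 : exists_generator_ringClassGalOver K)
    (hMc : McCallum1991_pow_dvd_card_sha_primary_of_certificate)
    -- the pair: X11b@3 ∧ (ram) on a TAMAGAWA cell, and the HL frame
    (hX : ClassX11b W 3) (hram : Ram W 3) (htam : 3 ∣ W.tamagawaProduct)
    (hK : IsImaginaryQuadratic K) (hodd : Odd (NumberField.discr K))
    (hH : SatisfiesHeegnerHypothesis (W.conductorNorm ℤ) K)
    (hLt : (W.quadraticTwist (NumberField.discr K : ℚ)).entireLFunction 1 ≠ 0)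
    (hβ : (4 * (W.conductorNorm ℤ : ℤ)) ∣ β ^ 2 - NumberField.discr K) (hc : ¬ (3 : ℤ) ∣ Dt.c)
    -- the hypothesis: the 3-part of BSD for E/ℚ
    (hbsd : BSDp W 3)
    -- any level and datum on the frame
    {n : ℕ} (d : KolyvaginHeegnerData Dt β ι n)
    (hn : KolyvaginDescent.KolSupp (Zhang2014.IsKolyvaginPrime (W.conductorNorm ℤ) W K 3) n) :
    d.kolyvaginClass Nat.prime_three 1 = 0 := by
  haveI : Fact (Nat.Prime 3) := ⟨Nat.prime_three⟩
  by_contra hne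
  have hmult : W.HasMultiplicativeReductionAtPrime 3 := hX.2.2.1
  have hirr : Irr W 3 := hX.2.2.2
  have hρ : Surj W 3 := surj_of_irr_of_ram W 3 hirr hram
  -- tower surjectivity at a multiplicative 3, non-CM, `3 ∤ d_K`, `3 ∤ #𝓞_K^×`, `d_K ∉ {−3, −4}`, `d_K < 0`
  have hsurj : ∀ m : ℕ, W.HasSurjectiveModNGaloisRep (3 ^ m : ℕ) :=
    Rank1Residual.surjective_pow_three_of_mult_of_tateLine W hmult hρ
  have hCM : ¬ W.HasCM := not_hasCM_of_hasMultiplicativeReductionAtPrime' W hmult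
  obtain ⟨h3d, hμ⟩ := not_dvd_discr_and_not_dvd_torsionOrder_of_heegner hK hH (p := 3) (by decide)
    (dvd_conductorNorm_of_classX11b hX)
  have h3 : NumberField.discr K ≠ -3 := by
    intro h
    exact h3d (h ▸ ⟨-1, by norm_num⟩)
  have h4 : NumberField.discr K ≠ -4 := by
    intro h
    rw [h] at hodd
    exact (Int.not_odd_iff_even.mpr ⟨-2, by norm_num⟩) hodd
  have hDneg : NumberField.discr K < 0 := by
    have hND : IsCoprime (W.conductorNorm ℤ : ℤ) (NumberField.discr K) := by
      have h := Literature.SatisfiesHeegnerHypothesis.coprime_discr hK.1 hH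
      refine Int.isCoprime_iff_gcd_eq_one.mpr ?_
      rw [Int.gcd_eq_natAbs, Int.natAbs_natCast]
      exact h
    have hlt := discr_lt_neg_four_of_isCoprime_of_dvd_sq_sub hK hND (dvd_conductorNorm_of_classX11b hX) hβ
    omega
  -- the oriented Heegner datum, THE Heegner point `P = y_K ∈ E(K)`, a minimal model of the twist + its transports
  obtain ⟨H, hHβ⟩ := exists_heegnerDatum (W.conductorNorm ℤ) hDneg hβ
  obtain ⟨P, hP⟩ := heegnerPointComplex_mem_range_map_holds (W.conductorNorm ℤ) W K hK hH Dt H ι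
  have hD0 : (NumberField.discr K : ℚ) ≠ 0 := by exact_mod_cast NumberField.discr_ne_zero K
  haveI hEt : (W.quadraticTwist (NumberField.discr K : ℚ)).IsElliptic := W.isElliptic_quadraticTwist hD0
  obtain ⟨Cd, hCd⟩ := hasGlobalMinimalModel_rat_holds (W.quadraticTwist (NumberField.discr K : ℚ))
  haveI := hCd
  set Wd := Cd • W.quadraticTwist (NumberField.discr K : ℚ) with hWd_def
  have hWd : Cd • W.quadraticTwist (NumberField.discr K : ℚ) = Wd := rfl
  have hmultd : Wd.HasMultiplicativeReductionAtPrime 3 :=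
    hasMultiplicativeReductionAtPrime_twist_of_heegner' W 3 K hK hH hmult Cd hWd
  have hirrd : Wd.HasIrreducibleModPGaloisRep 3 := hasIrreducibleModPGaloisRep_twist_model W 3 K hK.1 hirr Cd hWd
  have hramd : Ram Wd 3 := ram_twist_of_heegner W 3 K hK hH hram Cd hWd
  have htamd : padicValNat 3 Wd.tamagawaProduct = padicValNat 3 W.tamagawaProduct :=
    X2.padicValNat_tamagawaProduct_twist_of_heegner_of_odd W 3 (by decide) K hK hodd h3d hH Cd hWd
  have hu : padicValRat 3 (Cd.u : ℚ) = 0 := padicValRat_u_eq_zero_of_twist_minimal W 3 K hK hH hmult Cd hWd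
  have hLt' : (W.quadraticTwist (NumberField.discr K : ℚ)).entireLFunction = Wd.entireLFunction := by
    rw [← hWd, entireLFunction_smul]
  have hLd1 : Wd.entireLFunction 1 ≠ 0 := by rw [← hLt']; exact hLt
  have hrd : Wd.analyticRank = 0 := (Wd.analyticRank_eq_zero_iff_holds (hmod Wd)).2 hLd1
  have hfinSd : Finite Wd.sha := (hGZK Wd (by omega)).2
  obtain ⟨qd, hqd, hvqd⟩ := hSk Wd 3 le_rfl (Or.inr hmultd) hirrd hramd hLd1 hfinSd
  -- the Heegner-index IDENTITY over `K` from `BSD(E,3)` (eisenstein-p2's backwards descent)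
  have hid : IndexIdentityAt W 3 K P :=
    X2.indexIdentityAt_of_bsdp W 3 (W.conductorNorm ℤ) K Dt H ι P hGZ hKo hGZK hmod hK hH hP (by decide)
      (by exact_mod_cast hc) hμ hX.1 hLt Wd Cd hWd ⟨qd, hqd, hvqd⟩ htamd hu hbsd
  -- arithmetic of `E(K)`
  have hPinf : ¬ IsOfFinAddOrder P :=
    not_isOfFinAddOrder_of_heegner_of_analyticRank_eq_one W (W.conductorNorm ℤ) K Dt H ι P hGZ hmod hX.1 hK hH
      hLt hP
  obtain ⟨hrank, hSha⟩ := hKo hK hH ⟨Dt, H, ι, hP⟩ hPinf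
  haveI : Finite (W.baseChange K).sha := hSha
  have hbot := torsionBy_eq_bot_of_isImaginaryQuadratic_of_hasIrreducibleModPGaloisRep W K hK Nat.prime_three hirr
  have hiv : ∀ x : (W.baseChange K).toAffine.Point, 3 • x = 0 → x = 0 := fun x hx ↦ by
    have hmem : x ∈ AddSubgroup.torsionBy (W.baseChange K).toAffine.Point ((3 : ℕ) : ℤ) := by
      rw [mem_torsionBy_iff, natCast_zsmul]
      exact hx
    rw [hbot] at hmem
    exact hmem
  haveI : Module.Finite ℤ (W.baseChange K).toAffine.Point := (W.baseChange K).module_finite_point_holds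
  obtain ⟨M₀, x₀, hx₀, hmax⟩ := exists_pow_smul_eq_and_forall_ne hPinf (p := 3) (by norm_num)
  have hdiv : ∃ Q : (W.baseChange K).toAffine.Point, ((3 ^ M₀ : ℕ) : ℤ) • Q = P :=
    ⟨x₀, by rw [natCast_zsmul]; exact hx₀⟩
  have hndiv : ¬ ∃ Q : (W.baseChange K).toAffine.Point, ((3 ^ (M₀ + 1) : ℕ) : ℤ) • Q = P := by
    rintro ⟨Q, hQ⟩
    exact hmax Q (by rw [← natCast_zsmul]; exact hQ)
  -- the conductor-1 datum (Gross §3) and `P(1) = y_K` in `E(K̄)` (Shimura reciprocity)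
  obtain ⟨d₁⟩ := Summit.BirchSwinnertonDyer.BirchSwinnertonDyer.Theorems.nonempty_kolyvaginHeegnerData_of_grossCM
    h1 h2 hK hH Dt β ι hβ squarefree_one (by simp)
  have hPd : d₁.toGeomPoints d₁.derivedPoint = toGeomPoints (W.baseChange K) P :=
    KolyvaginBottom.toGeomPoints_derivedPoint_one_eq hrec hK hH hP d₁ hHβ
  -- bridges: `ord₃[E(K):ℤP] = M₀`, `ord₃ #Ш = ord₃ #Ш[3^∞]`
  haveI : Finite (AddCommGroup.torsion (W.baseChange K).toAffine.Point) :=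
    WeierstrassCurve.finite_torsion_point (W := W.baseChange K)
  obtain ⟨cc, Q, hcQ, hcker⟩ := RankOne.exists_coord_of_mordellWeilRank_eq_one (W.baseChange K) hrank
  have hidx : padicValNat 3 (AddSubgroup.zmultiples P).index = M₀ :=
    padicValNat_index_zmultiples_eq_of_divisibility cc Q hcQ hcker hiv P hdiv hndiv
  have hsha : padicValNat 3 (W.baseChange K).shaOrder =
      padicValNat 3 (Nat.card (AddCommGroup.primaryComponent (W.baseChange K).sha 3)) :=
    padicValNat_shaOrder_eq (W.baseChange K) 3
  -- the non-zero class is a level-1 certificate: `2 M₀ ≤ ord₃ #Ш(E/K)[3^∞]` (McCallum Cor. 5.6)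
  have hℓ : ∀ ℓ ∈ n.primeFactors, Zhang2014.IsKolyvaginPrime (W.conductorNorm ℤ) W K 3 ℓ ∧
      0 + 1 ≤ Zhang2014.kolyvaginIndex W 3 ℓ :=
    fun ℓ hℓ ↦ ⟨hn.2 ℓ hℓ, (hn.2 ℓ hℓ).2.2.2.2.2⟩
  have hcert : ¬ ∃ Q : (W.baseChange (ringClassField K ι n)).toAffine.Point,
      ((3 ^ (0 + 1) : ℕ) : ℤ) • Q = d.derivedPoint :=
    not_pDiv_of_kolyvaginClass_ne_zero d hne
  have hle := two_mul_sub_le_padicValNat_card_sha_primary_of_certificate hMc W hCM K hK h3 h4 hH 3 (by norm_num)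
    hsurj Dt β ι d₁ P hPd hPinf hdiv hndiv d hn.1 hℓ hcert
  -- `ord₃ ∏c ≥ 1`
  have htam1 : 1 ≤ padicValNat 3 W.tamagawaProduct :=
    one_le_padicValNat_of_dvd (W.tamagawaProduct_pos_holds).ne' htam
  unfold IndexIdentityAt at hid
  rw [hidx, hsha] at hid
  omega

/-! ## §2 The dichotomy granted `BSD(E,3)`, and the tightness of the crux's Tamagawa binder -/

/-- **Granted `BSD(E,3)` at an X11b@3 ∧ (ram) curve, a Hoffstein–Luo frame carries a non-zero mod-3 Kolyvagin class
iff `3 ∤ ∏ c_ℓ`** — W. Zhang's Tamagawa hypothesis is exactly sharp at `3 ∥ N`: ⟸ is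
`Koly.kolyvaginClass_one_ne_zero_of_bsdp_of_hlFrame` (McCallum's divisibility half, `hMcU`), ⟹ is LEMMA V (§1,
certificate half `hMc`). CONDITIONAL on every binder (in particular `BSDp W 3`); nothing is booked.
[cite: WZhang2014, Thm. 1.1 and Thm. 10.2] [cite: Jetchev2008, §1 (1)] [cite: McCallumLMS1991, §5 Cor. 5.6] -/
theorem exists_kolyvaginClass_one_ne_zero_iff_not_dvd_tamagawa_of_bsdp
    (W : WeierstrassCurve ℚ) [W.IsElliptic] [W.IsGloballyMinimal] [NeZero (W.conductorNorm ℤ)]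
    (K : Type) [Field K] [NumberField K]
    (Dt : ModularParametrizationData W (W.conductorNorm ℤ)) (β : ℤ) (ι : K →+* ℂ)
    (hGZ : gross_zagier (W.conductorNorm ℤ) W K) (hKo : kolyvagin (W.conductorNorm ℤ) W K)
    (hSk : Skinner2016.thmC_padicValRat_bsd_rank_zero)
    (hGZK : rank_eq_analyticRank_of_analyticRank_le_one) (hmod : hasEntireLFunction_rat)
    (hrec : heegnerPointOfConductor_one_galoisConj (W.conductorNorm ℤ) W K)
    (h1 : phi_heegnerPointOfConductor_mem_range_map_ringClassField (W.conductorNorm ℤ) W K)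
    (h2 : exists_generator_ringClassGalOver K)
    (hMc : McCallum1991_pow_dvd_card_sha_primary_of_certificate)
    (hMcU : McCallum1991_padicValNat_card_sha_primary_add_le_of_globalDivisibility)
    (hX : ClassX11b W 3) (hram : Ram W 3)
    (hK : IsImaginaryQuadratic K) (hodd : Odd (NumberField.discr K))
    (hH : SatisfiesHeegnerHypothesis (W.conductorNorm ℤ) K)
    (hLt : (W.quadraticTwist (NumberField.discr K : ℚ)).entireLFunction 1 ≠ 0)
    (hβ : (4 * (W.conductorNorm ℤ : ℤ)) ∣ β ^ 2 - NumberField.discr K) (hc : ¬ (3 : ℤ) ∣ Dt.c)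
    (hbsd : BSDp W 3) :
    (∃ (n : ℕ) (d : KolyvaginHeegnerData Dt β ι n),
      KolyvaginDescent.KolSupp (Zhang2014.IsKolyvaginPrime (W.conductorNorm ℤ) W K 3) n ∧
        d.kolyvaginClass Nat.prime_three 1 ≠ 0) ↔ ¬ 3 ∣ W.tamagawaProduct := by
  constructor
  · rintro ⟨n, d, hn, hne⟩ htam
    exact hne (kolyvaginClass_one_eq_zero_of_bsdp_of_dvd_tamagawa W K Dt β ι hGZ hKo hSk hGZK hmod hrec h1 h2 hMc hX
      hram htam hK hodd hH hLt hβ hc hbsd d hn)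
  · intro htam
    exact kolyvaginClass_one_ne_zero_of_bsdp_of_hlFrame W K Dt β ι hGZ hKo hSk hGZK hmod hrec h1 h2 hMcU hX hram htam
      hK hodd hH hLt hβ hc hbsd

end Summit.BirchSwinnertonDyer.Rank1Residual.X11b.Three.Koly

namespace Summit.BirchSwinnertonDyer.BirchSwinnertonDyer.Theorems

open WeierstrassCurve NumberField Literature.NumberTheory.EllipticCurves
  Literature.NumberTheory.EllipticCurves.ModularForms
  Literature.NumberTheory.EllipticCurves.Rank1Residual
  Summit.BirchSwinnertonDyer.Rank1Residual Summit.BirchSwinnertonDyer.Rank1Residual.X11b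

/-- **TIGHTNESS of the Tamagawa binder of the deciding crux.**  The statement of `ZhangSharpFrameAtThreeHL` with its
binder `¬ 3 ∣ W.tamagawaProduct` DELETED is REFUTED by any single X11b@3 ∧ (ram) curve on a Tamagawa cell
(`3 ∣ ∏c`) satisfying `BSDp W 3`, at any Hoffstein–Luo frame of it (LEMMA V). The witness data are HYPOTHESES
(the existence of such a curve with `BSD(E,3)` is believed — 568 TRUE-OPEN (T2′)@3 classes — but is not a tree
theorem); so this is a tightness lemma modulo that hypothesis, not a refutation of anything filed. CONDITIONAL on
every binder; nothing is booked. [cite: WZhang2014, Thm. 1.1 (hypothesis on c_ℓ)] [cite: Jetchev2008, §1 (1)] -/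
theorem not_zhangFrameHL_dropTam_of_bsdp_at_tamagawaCell
    (hSk : Skinner2016.thmC_padicValRat_bsd_rank_zero)
    (hGZK : rank_eq_analyticRank_of_analyticRank_le_one) (hmod : hasEntireLFunction_rat)
    (hMc : McCallum1991_pow_dvd_card_sha_primary_of_certificate)
    -- ONE Tamagawa-cell curve with BSD(E,3) and an HL frame (hypotheses)
    (W : WeierstrassCurve ℚ) [W.IsElliptic] [W.IsGloballyMinimal] [NeZero (W.conductorNorm ℤ)]
    (K : Type) [Field K] [NumberField K]
    (Dt : ModularParametrizationData W (W.conductorNorm ℤ)) (β : ℤ) (ι : K →+* ℂ)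
    (hGZ : gross_zagier (W.conductorNorm ℤ) W K) (hKo : kolyvagin (W.conductorNorm ℤ) W K)
    (hrec : heegnerPointOfConductor_one_galoisConj (W.conductorNorm ℤ) W K)
    (h1 : phi_heegnerPointOfConductor_mem_range_map_ringClassField (W.conductorNorm ℤ) W K)
    (h2 : exists_generator_ringClassGalOver K)
    (hX : ClassX11b W 3) (hram : Ram W 3) (htam : 3 ∣ W.tamagawaProduct) (hbsd : BSDp W 3)
    (hK : IsImaginaryQuadratic K) (hodd : Odd (NumberField.discr K))
    (hH : SatisfiesHeegnerHypothesis (W.conductorNorm ℤ) K)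
    (hLt : (W.quadraticTwist (NumberField.discr K : ℚ)).entireLFunction 1 ≠ 0) (h3 : NumberField.discr K ≠ -3)
    (hβ : (4 * (W.conductorNorm ℤ : ℤ)) ∣ β ^ 2 - NumberField.discr K) (hc : ¬ (3 : ℤ) ∣ Dt.c) :
    ¬ (∀ (W : WeierstrassCurve ℚ) [W.IsElliptic] [W.IsGloballyMinimal] [NeZero (W.conductorNorm ℤ)]
        (K : Type) [Field K] [NumberField K]
        (Dt : ModularParametrizationData W (W.conductorNorm ℤ)) (β : ℤ) (ι : K →+* ℂ),
        ClassX11b W 3 → W.HasMultiplicativeReductionAtPrime 3 → Rank1Residual.Surj W 3 → Rank1Residual.Ram W 3 →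
        IsImaginaryQuadratic K → Odd (NumberField.discr K) → SatisfiesHeegnerHypothesis (W.conductorNorm ℤ) K →
        (W.quadraticTwist (NumberField.discr K : ℚ)).entireLFunction 1 ≠ 0 → NumberField.discr K ≠ -3 →
        (4 * (W.conductorNorm ℤ : ℤ)) ∣ β ^ 2 - NumberField.discr K → ¬ (3 : ℤ) ∣ Dt.c →
        ∃ (n : ℕ) (d : KolyvaginHeegnerData Dt β ι n),
          KolyvaginDescent.KolSupp (Zhang2014.IsKolyvaginPrime (W.conductorNorm ℤ) W K 3) n ∧
            d.kolyvaginClass Nat.prime_three 1 ≠ 0) := by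
  intro h
  have hmult : W.HasMultiplicativeReductionAtPrime 3 := hX.2.2.1
  have hρ : Surj W 3 := surj_of_irr_of_ram W 3 hX.2.2.2 hram
  obtain ⟨n, d, hn, hne⟩ := h W K Dt β ι hX hmult hρ hram hK hodd hH hLt h3 hβ hc
  exact hne (Summit.BirchSwinnertonDyer.Rank1Residual.X11b.Three.Koly.kolyvaginClass_one_eq_zero_of_bsdp_of_dvd_tamagawa
    W K Dt β ι hGZ hKo hSk hGZK hmod hrec h1 h2 hMc hX hram htam hK hodd hH hLt hβ hc hbsd d hn)

end Summit.BirchSwinnertonDyer.BirchSwinnertonDyer.Theorems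

end
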